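/-
Copyright: H21 programme, solo seat `solo-RiemannHypothesis-informed` (session 6).
-/
import Summits.RiemannHypothesis.RiemannHypothesis.Theorems.SoloInformedCompanionPrice

/-!
# The price of a companion, `M = 0` (solo-informed, T39₀)

With no companion on the right of the line in the zone `|Im ρ - γ₀| < 2πK`, the exponential sum
of T39g has a single term, `U(τ) = m₀ Φ_K(η)² e^{ητ}`, and `|Φ_K(η)|² ≥ 3` by flatness; taking
`τ = 2a - 2` in `norm_combExpSum_le` gives the double-log window with the comb constants and
**no Turán loss**:

`3 e^{η(2a-2)} ≤ 20π A₁ C_χ² (2K+1) log(|γ₀| + πK + 2)`.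

(The tree's Turán constant `c(n, τ₀) = e^{-n}(250(τ₀+1))^{-(n+1)}` would cost
`2 log(250(2a-2)) + 1` here even though a one-term sum needs no Turán theorem at all; this file
records the honest `M = 0` case separately.)
-/

noncomputable section

open Real MeasureTheory Filter Complex Set Literature.NumberTheory.LFunctions
open scoped Topology ContDiff ComplexConjugate

namespace Summit.RiemannHypothesis.RiemannHypothesis.Theorems

open Companion

/-- **T39₀ (no companion: the double-log window with comb constants).**  If the only zero with
`Re ρ > ½` and `|Im ρ - γ₀| < 2πK` is the target itself, then
`3 e^{η(2a-2)} ≤ 20π A₁ C_χ² (2K+1) log(|γ₀| + πK + 2)` — no Turán step, no Turán constant. -/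
theorem companion_window_zero {η : ℝ} (hη : 0 < η) (K q : ℕ) (hq : 2 ≤ q) (hK : 1 ≤ K)
    {a γ₀ : ℝ} (ha : 2 ≤ a) (hγ : 2 * π * K ≤ |γ₀|)
    (hK2 : Real.exp a * (2 * combL q / (π * K) ^ (q - 2)) ^ 2 ≤ combC ^ 2)
    (hε : 2 * combL q / (π ^ q * K ^ (q - 1)) ≤ 1 / 4)
    (hcount : {ρ : ℂ | riemannZeta ρ = 0 ∧ 1 / 2 < ρ.re ∧
        |ρ.im - γ₀| < 2 * π * K}.encard ≤ 1)
    (hE : 0 ≤ weilGroundEnergy a) (hζ : riemannZeta (1 / 2 + η + γ₀ * I) = 0) :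
    3 * Real.exp (η * (2 * a - 2)) ≤
      20 * π * zetaDensityConst * combC ^ 2 * (2 * K + 1) * Real.log (|γ₀| + π * K + 2) := by
  classical
  have hKr : (1 : ℝ) ≤ K := by exact_mod_cast hK
  set Z : Set ℂ := {ρ : ℂ | riemannZeta ρ = 0 ∧ 1 / 2 < ρ.re ∧ |ρ.im - γ₀| < 2 * π * K}
  have hcount' : Z.encard ≤ ((1 : ℕ) : ℕ∞) := by rwa [Nat.cast_one]
  have hfin : Z.Finite := Set.finite_of_encard_le_coe hcount'
  set P : Finset ℂ := hfin.toFinset with hPdef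
  have hzone : (2 : ℝ) * π * K = π * ((K : ℝ) + K) := by ring
  have hmem : ∀ ρ, ρ ∈ P ↔ riemannZeta ρ = 0 ∧ 1 / 2 < ρ.re ∧ |ρ.im - γ₀| < π * (K + K) := by
    intro ρ; rw [hPdef, hfin.mem_toFinset, ← hzone]; rfl
  set ρ₀ : ℂ := 1 / 2 + η + γ₀ * I with hρ₀
  have hρ₀re : ρ₀.re = 1 / 2 + η := by simp [hρ₀]
  have hρ₀im : ρ₀.im = γ₀ := by simp [hρ₀]
  have hρ₀P : ρ₀ ∈ P := by
    rw [hmem]; refine ⟨hζ, by rw [hρ₀re]; linarith, ?_⟩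
    rw [hρ₀im, sub_self, abs_zero]; positivity
  have hPeq : P = {ρ₀} := by
    refine Finset.eq_singleton_iff_unique_mem.mpr ⟨hρ₀P, fun ρ hρ ↦ ?_⟩
    have hcard : P.card ≤ 1 := by
      have h := hfin.encard_eq_coe_toFinset_card
      have : Z.encard ≤ 1 := by simpa using hcount
      rw [h] at this
      exact_mod_cast this
    exact Finset.card_le_one.mp hcard ρ hρ ρ₀ hρ₀P
  have hγK : π * ((K : ℝ) + K) ≤ |γ₀| := by linarith
  have hP : ∀ ρ ∈ P, riemannZeta ρ = 0 ∧ 1 / 2 < ρ.re ∧ |ρ.im - γ₀| < π * (K + K) :=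
    fun ρ hρ ↦ (hmem ρ).mp hρ
  have hcomp := zone_complete hγK hmem
  have hU := norm_combExpSum_le (J := K) hq hK ha hγK hK2 P hP hcomp hE (τ := 2 * a - 2)
    (by linarith) le_rfl
  rw [hPeq, Finset.sum_singleton] at hU
  -- flatness at the target: `λ₀ = η`, `Im λ₀ = 0`
  have hΛ : (ρ₀ - 1 / 2 - γ₀ * I : ℂ) = η := by rw [hρ₀]; ring
  rw [hΛ] at hU
  have hflat : ‖combXform K (η : ℂ) - 2‖ ≤ 2 * combL q / (π ^ q * K ^ (q - 1)) :=
    norm_combXform_sub_two_le hq hK le_rfl (by rw [Complex.ofReal_re, abs_le]; constructor <;>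
      linarith [(hP ρ₀ hρ₀P).2.1, re_lt_one_of_riemannZeta_eq_zero hζ]) (by simp)
  obtain ⟨_, h3, _⟩ := flat_multiplier hflat hε
  have hm1 : (1 : ℝ) ≤ riemannZetaZeroOrder ρ₀ := by
    have := (riemannZetaZeroOrder_pos_iff (ne_one_of_riemannZeta_eq_zero hζ)).mpr hζ
    exact_mod_cast this
  have hnorm : ‖((riemannZetaZeroOrder ρ₀ : ℝ) : ℂ) * (combXform K η ^ 2 * cexp (η * ↑(2 * a - 2)))‖
      = riemannZetaZeroOrder ρ₀ * (‖combXform K η‖ ^ 2 * Real.exp (η * (2 * a - 2))) := by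
    rw [norm_mul, norm_mul, norm_pow, Complex.norm_real, Real.norm_eq_abs,
      abs_of_nonneg (by linarith), ← Complex.ofReal_mul, Complex.norm_exp, Complex.ofReal_re]
  rw [hnorm] at hU
  have hE0 := Real.exp_pos (η * (2 * a - 2))
  calc 3 * Real.exp (η * (2 * a - 2)) ≤ 1 * (3 * Real.exp (η * (2 * a - 2))) := by rw [one_mul]
    _ ≤ riemannZetaZeroOrder ρ₀ * (‖combXform K η‖ ^ 2 * Real.exp (η * (2 * a - 2))) := by
        apply mul_le_mul hm1 _ (by positivity) (by linarith)
        exact mul_le_mul_of_nonneg_right h3 hE0.le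
    _ ≤ _ := hU

end Summit.RiemannHypothesis.RiemannHypothesis.Theorems
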